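import Summits.NavierStokesRegularity.NavierStokesRegularity.Theorems.ScenarioCensusRowF5lgBarrier
import HarnessLib

/-!
# Census rows F5lg / F5r (ns-idea-4 LINE «log-gate») — part 5/5: `logGateCriterion_of` (rung R, sorry-free), small-tube form, `Row_F5` from K1,
# row F5r print form PROVED, the ⟨19059⟩ reduction; census keys

Re-homed for the scenario census (typer seat ns-census-typer-1 g5; lead g7 PORT ORDER 2026-08-28T16:11Z, MINT INTENT F5lg 16:11Z)
from ns-idea-4 g10's LINE g10-2 «log-gate» v1.1 (`pub/ideators/ns-idea-4/lines/log-gate/LogGate_v1_1.lean`, sha16 136999c2b89a0c68,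
1428 l.; lead lean check rc 0 / 0 sorry, std axioms), split into five files for the 400-line rule:
`ScenarioCensusRowF5lgGate` (§1–§2: gate, rung R, crux K1, compositions, O3 from the class, tube barriers, swirl data) →
`ScenarioCensusRowF5lgSlice` (§2b slice calculus, + the two `horiz_*` lemmas of §2c) → `ScenarioCensusRowF5lgTube` (§2c O2
`tubeComparison_holds`) → `ScenarioCensusRowF5lgBarrier` (§3 log barrier, §4 assembly at ν = 1, O4 dilation) → `ScenarioCensusRowF5lg`
(§5–§7: `logGateCriterion_of`, small-tube form, `RowF5rPrint` / `rowF5rPrint_holds`, the ⟨19059⟩ reduction; census keys `Row_F5lg`, `Row_F5r`).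
Lean text verbatim in namespace `…Theorems.ScenarioCensus.LogGate` (the line's `…Cruxes.ScenarioCensusRowF5.LogGateLine` re-homed;
typer edits: docstrings added where missing, non-bib cite tags turned into prose).

No census value is asserted here (the lead books F5lg / F5r); `Row_F5` stays OPEN (K1 `AprioriLogGate` is declared F5-strength);
NS regularity is NOT proved; no summit statement is proved by this file.
-/

noncomputable section
set_option linter.dupNamespace false

open Literature.Analysis.FluidPDE MeasureTheory Set Filter Topology
open scoped ENNReal NNReal RealInnerProductSpace

namespace Summit.NavierStokesRegularity.NavierStokesRegularity.Theorems.ScenarioCensus.LogGate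

open Summit.NavierStokesRegularity.NavierStokesRegularity.Theorems
open Summit.NavierStokesRegularity.NavierStokesRegularity.Theorems.ScenarioCensus

/-- **R is a THEOREM (v1.1).** The log-gate criterion for every viscosity: in the standing Leray–Hopf axisymmetric class on
`[0,T)`, `u_r ≥ −ν(2 − c/log(1/r))/r` for `0 < r ≤ δ₀` (`δ₀ < 1/2`, `c > 5/2`) implies `HasSmoothExtensionPast ν 0 u T`.
Sorry-free; ingredients: O1 `logBarrier_isTubeBarrier`, O2 `tubeComparison_holds`, O3 `wei_window` +
`Wei2016_logModulus_regularity_holds` (tree), O4 `logScaling_holds`. [new] -/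
theorem logGateCriterion_of : LogGateCriterion :=
  logScaling_holds (logGateCriterionNuOne_of_comparison tubeComparison_holds)

/-- **R ⇔ R′ in kernel** (idea-crit-3 P1; structural — does not use that either side is proved): R → R′ by sub-range
(`exp(−c/2) < 1/2`), R′ → R by restricting the gate to the tube `min δ₀ (exp(−c/2))` (`HasLogGate.mono`). -/
theorem logGateCriterion_iff_smallTube : LogGateCriterion ↔ LogGateCriterionSmallTube := by
  constructor
  · intro h c δ₀ ν T hc hδ hδe hν hT u p hcl hLH hdec hbd hax hg
    exact h c δ₀ ν T hc hδ (hδe.trans_lt (exp_neg_half_lt_half hc)) hν hT u p hcl hLH hdec hbd hax hg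
  · intro h c δ₀ ν T hc hδ _ hν hT u p hcl hLH hdec hbd hax hg
    exact h c (min δ₀ (Real.exp (-(c / 2)))) ν T hc (lt_min hδ (Real.exp_pos _)) (min_le_right _ _) hν hT u p hcl
      hLH hdec hbd hax (hg.mono (min_le_left _ _))

/-- **R′ is a THEOREM (v1.1).** -/
theorem logGateCriterionSmallTube_holds : LogGateCriterionSmallTube :=
  logGateCriterion_iff_smallTube.1 logGateCriterion_of

/-- Census row F5 BY NAME, modulo ONLY the declared row-strength crux K1. -/
theorem Row_F5_of (hK : AprioriLogGate) : Row_F5 :=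
  row_F5_of logGateCriterion_of hK

/-- ⟨stmt-NavierStokesRegularity-1964⟩ BY NAME, same input. -/
theorem AxisymSwirlRegular_of (hK : AprioriLogGate) :
    Summit.NavierStokesRegularity.NavierStokesRegularity.Theses.TypeIIInviscidRelaxation.AxisymSwirlRegular :=
  axisymSwirlRegular_of logGateCriterion_of hK

/-! ## §7 COROLLARY (v1.1, PROVED): census row F5r — the print criteria `v_r ≥ −M/r`, `M < 2` (Pan 2017 `M = 1`,
Zujin Zhang 2018 `1 < M < 2`; census: EXCLUDED-IN-PRINT-NOT-TREE, no tree decl) — follow from R, in a SHARPER form: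
the one-sided bound is needed only on a tube `0 < r ≤ δ` around the axis, for every `M < 2` and every viscosity. -/

/-- **Regularity under `u_r ≥ −νM/r` near the axis, `M < 2` (PROVED; sharper than print's row F5r).** Apply R with
`c = 3`, `δ₀ = min δ (min (1/4) (exp(−3/(2−M))))`: for `r ≤ exp(−3/(2−M))` one has `3/log(1/r) ≤ 2 − M`, so
`−νM/r ≥ −ν(2 − 3/log(1/r))/r` and the solution is in the gate `HasLogGate 3 δ₀ ν T`. [new; cf. X. Pan, Acta Appl. Math.
150 (2017) 103–109 (`M = 1`); Zujin Zhang, JMAA 2018 (`1 < M < 2`), as cited by Q. S. Zhang arXiv:2604.07785 p. 4] -/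
theorem hasSmoothExtensionPast_of_radial_inflow_lt_two {ν T M δ : ℝ} (hν : 0 < ν) (hT : 0 < T) (hM : M < 2)
    (hδ : 0 < δ) {u : ℝ → E3 → E3} {p : ℝ → E3 → ℝ}
    (hcl : IsClassicalNSSolutionOn (Ico 0 T) ν 0 u p) (hLH : IsLerayHopfOn T ν 0 (u 0) u)
    (hdec : HasRapidSpatialDecay (u 0)) (hbd : ∀ T' < T, ∃ B : ℝ, ∀ t ∈ Icc 0 T', ∀ x, ‖u t x‖ ≤ B)
    (hax : ∀ t ∈ Ico 0 T, IsAxisymmetric (u t))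
    (hin : ∀ t ∈ Ico 0 T, ∀ x : E3, 0 < cylRadius x → cylRadius x ≤ δ →
      -(ν * M) / cylRadius x ≤ radialVelocity (u t) x) :
    HasSmoothExtensionPast ν 0 u T := by
  set δ₀ : ℝ := min δ (min (1 / 4) (Real.exp (-(3 / (2 - M))))) with hδ₀
  have hδ₀pos : 0 < δ₀ := lt_min hδ (lt_min (by norm_num) (Real.exp_pos _))
  have hδ₀half : δ₀ < 1 / 2 :=
    (min_le_right _ _).trans_lt ((min_le_left _ _).trans_lt (by norm_num))
  have hδ₀δ : δ₀ ≤ δ := min_le_left _ _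
  have hδ₀exp : δ₀ ≤ Real.exp (-(3 / (2 - M))) := (min_le_right _ _).trans (min_le_right _ _)
  refine logGateCriterion_of 3 δ₀ ν T (by norm_num) hδ₀pos hδ₀half hν hT u p hcl hLH hdec hbd hax ?_
  intro t ht x hr0 hrδ
  have h1 := hin t ht x hr0 (hrδ.trans hδ₀δ)
  have h2M : 0 < 2 - M := by linarith
  have hℓ : 3 / (2 - M) ≤ -Real.log (cylRadius x) := by
    have := Real.log_le_log hr0 (hrδ.trans hδ₀exp)
    rw [Real.log_exp] at this
    linarith
  have hℓpos : 0 < -Real.log (cylRadius x) := lt_of_lt_of_le (div_pos (by norm_num) h2M) hℓ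
  have h3 : 3 / (-Real.log (cylRadius x)) ≤ 2 - M := by
    rw [div_le_iff₀ hℓpos]
    have := (div_le_iff₀ h2M).1 hℓ
    linarith
  have h4 : ν * M / cylRadius x ≤ logInflowEnvelope 3 ν (cylRadius x) := by
    unfold logInflowEnvelope
    exact div_le_div_of_nonneg_right (mul_le_mul_of_nonneg_left (by linarith) hν.le) hr0.le
  have e : -(ν * M) / cylRadius x = -(ν * M / cylRadius x) := by ring
  linarith

/-- **Row F5r of the census, print form, as a typed Prop** (no tree decl so far): a classical Leray–Hopf axisymmetric solution
on `[0,T)` from a rapidly decaying datum, bounded on closed sub-strips, with `u_r ≥ −νM/r` off the axis for some `M < 2`,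
extends past `T`.  (Print: X. Pan, Acta Appl. Math. 150 (2017) 103–109, `M = 1`; Zujin Zhang, JMAA 461 (2018), `1 < M < 2`; as cited
by Q. S. Zhang, arXiv:2604.07785 p. 4 — venue per the census lit seat.) -/
def RowF5rPrint : Prop :=
  ∀ (ν T M : ℝ), 0 < ν → 0 < T → M < 2 → ∀ (u : ℝ → E3 → E3) (p : ℝ → E3 → ℝ),
    IsClassicalNSSolutionOn (Ico 0 T) ν 0 u p → IsLerayHopfOn T ν 0 (u 0) u → HasRapidSpatialDecay (u 0) →
    (∀ T' < T, ∃ B : ℝ, ∀ t ∈ Icc 0 T', ∀ x, ‖u t x‖ ≤ B) → (∀ t ∈ Ico 0 T, IsAxisymmetric (u t)) →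
    (∀ t ∈ Ico 0 T, ∀ x : E3, 0 < cylRadius x → -(ν * M) / cylRadius x ≤ radialVelocity (u t) x) →
    HasSmoothExtensionPast ν 0 u T

/-- **Row F5r — PROVED** (from `hasSmoothExtensionPast_of_radial_inflow_lt_two` with `δ = 1`). [new] -/
theorem rowF5rPrint_holds : RowF5rPrint := by
  intro ν T M hν hT hM u p hcl hLH hdec hbd hax hin
  exact hasSmoothExtensionPast_of_radial_inflow_lt_two hν hT hM one_pos hcl hLH hdec hbd hax
    (fun t ht x hr0 _ => hin t ht x hr0)

/-! ## §7b COROLLARY (v1.1, PROVED): the open tree crux ⟨stmt-NavierStokesRegularity-19059⟩ `OneSidedRadialCriterion`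
(`Theses/TypeIIInviscidRelaxation`, rank 7, OPEN: «r u_r ≥ −Cν on {r < δ} for SOME C ⇒ extension»; its docstring: «C < 2
follows modulo the Lei–Zhang axis criterion … C ≥ 2 is OPEN and is the content») is REDUCED IN KERNEL to its `C ≥ 2` part:
the `C < 2` case is a theorem here (via Wei, not Lei–Zhang), and `OneSidedRadialCriterion ↔ OneSidedRadialCriterionGeTwo`. -/

/-- **⟨19059⟩ below the critical constant — PROVED**: in the class of `OneSidedRadialCriterion`, `r u_r ≥ −Cν` on
`{cylRadius < δ} × [0,T)` with `C < 2` implies `HasSmoothExtensionPast ν 0 u T`. [new in kernel; in print for the global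
bound: Pan 2017 (`C = 1`), Zujin Zhang 2018 (`1 < C < 2`)] -/
theorem oneSidedRadialCriterion_of_lt_two {ν T C δ : ℝ} (hν : 0 < ν) (hT : 0 < T) (hC : C < 2) (hδ : 0 < δ)
    {u : ℝ → E3 → E3} {p : ℝ → E3 → ℝ}
    (hcl : IsClassicalNSSolutionOn (Ico 0 T) ν 0 u p) (hLH : IsLerayHopfOn T ν 0 (u 0) u)
    (hbd : ∀ T' < T, ∃ M : ℝ, ∀ t ∈ Icc 0 T', ∀ x, ‖u t x‖ ≤ M) (hax : ∀ t ∈ Ico 0 T, IsAxisymmetric (u t))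
    (hdec : HasRapidSpatialDecay (u 0))
    (hin : ∀ t ∈ Ico 0 T, ∀ x : E3, cylRadius x < δ → -(C * ν) ≤ x 0 * u t x 0 + x 1 * u t x 1) :
    HasSmoothExtensionPast ν 0 u T := by
  refine hasSmoothExtensionPast_of_radial_inflow_lt_two (M := C) (δ := δ / 2) hν hT hC (half_pos hδ) hcl hLH hdec hbd
    hax ?_
  intro t ht x hr0 hrδ
  have h := hin t ht x (by linarith)
  rw [radialVelocity_eq_div']
  exact div_le_div_of_nonneg_right (by linarith [mul_comm C ν]) hr0.le

/-- ⟨19059⟩ restricted to constants `C ≥ 2` — the OPEN content of the one-sided radial criterion. [conjecture-shaped Prop;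
not claimed] -/
def OneSidedRadialCriterionGeTwo : Prop :=
  ∀ (ν T : ℝ), 0 < ν → 0 < T → ∀ (u : ℝ → E3 → E3) (p : ℝ → E3 → ℝ), IsClassicalNSSolutionOn (Ico 0 T) ν 0 u p →
    IsLerayHopfOn T ν 0 (u 0) u → (∀ T' < T, ∃ M : ℝ, ∀ t ∈ Icc 0 T', ∀ x, ‖u t x‖ ≤ M) →
    (∀ t ∈ Ico 0 T, IsAxisymmetric (u t)) → HasRapidSpatialDecay (u 0) →
    (∃ C δ : ℝ, 2 ≤ C ∧ 0 < δ ∧ ∀ t ∈ Ico 0 T, ∀ x : E3, cylRadius x < δ → -(C * ν) ≤ x 0 * u t x 0 + x 1 * u t x 1) →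
    HasSmoothExtensionPast ν 0 u T

/-- **Kernel reduction of the open crux ⟨19059⟩ to `C ≥ 2`** (BY NAME): `OneSidedRadialCriterion ↔ OneSidedRadialCriterionGeTwo`.
[new] -/
theorem oneSidedRadialCriterion_iff_geTwo :
    Summit.NavierStokesRegularity.NavierStokesRegularity.Theses.TypeIIInviscidRelaxation.OneSidedRadialCriterion ↔
      OneSidedRadialCriterionGeTwo := by
  constructor
  · rintro h ν T hν hT u p hcl hLH hbd hax hdec ⟨C, δ, -, hδ, hin⟩
    exact h ν T hν hT u p hcl hLH hbd hax hdec ⟨C, δ, hδ, hin⟩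
  · rintro h ν T hν hT u p hcl hLH hbd hax hdec ⟨C, δ, hδ, hin⟩
    rcases lt_or_ge C 2 with hC | hC
    · exact oneSidedRadialCriterion_of_lt_two hν hT hC hδ hcl hLH hbd hax hdec hin
    · exact h ν T hν hT u p hcl hLH hbd hax hdec ⟨C, δ, hC, hδ, hin⟩


end Summit.NavierStokesRegularity.NavierStokesRegularity.Theorems.ScenarioCensus.LogGate

namespace Summit.NavierStokesRegularity.NavierStokesRegularity.Theorems.ScenarioCensus

/-- Row-strength decomposition: the log-gate criterion (`LogGate.LogGateCriterion`, a theorem: `LogGate.logGateCriterion_of`) + the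
a-priori gate K1 (`LogGate.AprioriLogGate`, declared F5-strength, OPEN) ⇒ `Row_F5` (`LogGate.Row_F5_of`). -/
theorem row_F5_of_aprioriLogGate (hK : LogGate.AprioriLogGate) : Row_F5 := LogGate.Row_F5_of hK

/-- Census row F5r, PRINT FORM — (I ∨ II · forward, the frame of `Row_F5` · axisymmetric WITH swirl · one-sided SPACE-rate radial
inflow bound `u_r ≥ −νM/r` off the axis for some `M < 2`): extends past `T`, BY NAME `LogGate.RowF5rPrint` (VERBATIM; print:
X. Pan 2017 `M = 1`, Zujin Zhang 2018 `1 < M < 2`).  Closed by `row_F5r_excluded`; the census lead books the value. -/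
def Row_F5r : Prop := LogGate.RowF5rPrint

/-- F5r is PROVED in the tree: `LogGate.rowF5rPrint_holds` (from F5lg with `c = 3`; the one-sided bound is needed only on a tube).
No summit proved. -/
theorem row_F5r_excluded : Row_F5r := LogGate.rowF5rPrint_holds


/-! ## Census row F5lg (lead g7 GO 16:49Z: row text = the small-tube form R′ per ref §12.23; appended after the mint) -/

/-- Census row F5lg — (I ∨ II · forward, the FRAME of `Row_F5`: classical on `[0,T)`, Leray–Hopf from a rapidly decaying datum,
bounded on closed sub-strips, axisymmetric WITH swirl · plus the LOG GATE on a SMALL tube: `u_r ≥ −ν(2 − c/log(1/r))/r` for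
`0 < r ≤ δ₀`, some `c > 5/2` and `0 < δ₀ ≤ e^{−c/2}` — the non-vacuous form R′): extends past `T`, BY NAME
`LogGate.LogGateCriterionSmallTube` (ns-idea-4 LINE «log-gate» v1.1, VERBATIM).  Closed by `row_F5lg_excluded`; the census lead
books the value. -/
def Row_F5lg : Prop := LogGate.LogGateCriterionSmallTube

/-- F5lg is PROVED in the tree: `LogGate.logGateCriterionSmallTube_holds` (Wei 2016's log-modulus criterion + the tube
comparison O2 + the explicit log barrier O1 + time dilation O4).  No summit proved. -/
theorem row_F5lg_excluded : Row_F5lg := LogGate.logGateCriterionSmallTube_holds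

/-- The rung R as filed (`0 < δ₀ < 1/2`, vacuous for `δ₀ > e^{−c/2}`), BY NAME `LogGate.LogGateCriterion`; closed by
`LogGate.logGateCriterion_of`. -/
def Row_F5lgR : Prop := LogGate.LogGateCriterion

/-- R is PROVED in the tree: `LogGate.logGateCriterion_of`. -/
theorem row_F5lgR_excluded : Row_F5lgR := LogGate.logGateCriterion_of

/-- `Row_F5lgR ↔ Row_F5lg` (R ⇔ R′ in kernel: `LogGate.logGateCriterion_iff_smallTube`). -/
theorem row_F5lgR_iff_row_F5lg : Row_F5lgR ↔ Row_F5lg := LogGate.logGateCriterion_iff_smallTube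

/-- Lattice: F5 ⇒ F5lg BY NAME (`LogGate.logGateCriterion_of_row_F5` and R ⇒ R′). -/
theorem row_F5lg_of_row_F5 (h : Row_F5) : Row_F5lg :=
  LogGate.logGateCriterion_iff_smallTube.1 (LogGate.logGateCriterion_of_row_F5 h)

end Summit.NavierStokesRegularity.NavierStokesRegularity.Theorems.ScenarioCensus

end
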